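import Summits.ResolutionOfSingularities.ResolutionOfSingularities.Theorems.FrobeniusLadderFInjectiveMacaulayficationFedderOrigin
import Summits.ResolutionOfSingularities.ResolutionOfSingularities.Theorems.FrobeniusLadderFInjectiveMacaulayficationQuotLocalizationIso
import Summits.ResolutionOfSingularities.ResolutionOfSingularities.Theorems.FrobeniusLadderFInjectiveMacaulayficationDegreeZeroDescentLocal
import Summits.ResolutionOfSingularities.ResolutionOfSingularities.Theorems.FrobeniusLadderFInjectiveMacaulayficationE8Char5FiModel
import Mathlib.RingTheory.MvPolynomial.Basic
import HarnessLib

/-!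
# Fedder's test at a rational point of affine space (general `n` and `p`)

Support file for crux stmt-ResolutionOfSingularities-15315
(`FrobeniusLadder.FInjectiveMacaulayfication`, line `Sketch`, lead seat c7): stub
`stub_fedderAtRationalPoint` of the §14 ENGINE package (the calibration recipe "certified one-step
point blow-up of a hypersurface" needs, at each SINGULAR closed point of a chart `k[X]/(g)`, a
certificate that the local ring satisfies the per-stalk clause of the crux; at a `k`-rational point
the certificate is Fedder's criterion).

Let `k` be a field of characteristic `p`, `S = k[X₀, …, X_{n-1}]`, `g ∈ S` non-zero, `a ∈ kⁿ`, and
`Q` a maximal ideal of `S/(g)` lying over the rational point `a`: `Q ∩ S = ker (eval a) = (Xᵢ - aᵢ)`.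
We prove (`stub_fedderAtRationalPoint`): **if the translate `g(X + a)` passes Fedder's test at the
origin, `g(X + a)^(p-1) ∉ (X₀^p, …, X_{n-1}^p)`, then `(S/(g))_Q` satisfies the clause** — every
system of parameters is a weakly regular sequence and generates a Frobenius closed ideal
(Cohen–Macaulay + F-injective, inline form).

Proof: the translation `τ : Xᵢ ↦ Xᵢ + aᵢ` is a `k`-algebra automorphism of `S`
(`exists_translate_algEquiv`) with `eval 0 ∘ τ = eval a` (`constantCoeff_aeval_translate`), so
`g' = τ g = g(X + a)` is a non-zero element of `(X₀, …, X_{n-1})`. The tree's Fedder test AT THE ORIGIN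
(`Fedder.fedder_criterion_origin`, [Fedder1983] Prop. 1.7 / Thm. 1.12) gives the clause for
`S_{(X)}/(g')`; it moves to `(S/(g'))_{Q'}` for the maximal ideal `Q'` corresponding to `Q` under the
induced isomorphism `S/(g) ≅ S/(g')` (`Ideal.quotientEquiv`; `Q' ∩ S = τ (Q ∩ S) = (X)` since it
contains every `Xᵢ = τ (Xᵢ - aᵢ)` and `(X)` is maximal) by `QuotLocalizationIso.stub_quotLocalizationIso`,
and finally to `(S/(g))_Q` along the induced isomorphism of local rings
(`E8Char5FiModel.nonempty_ringEquiv_localization_comap`), each transport by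
`DegreeZeroDescent.inlineClause_of_ringEquiv`.

References: [Fedder1983] R. Fedder, F-purity and rational singularity, Trans. AMS 278 (1983),
Prop. 1.7 and Thm. 1.12.
-/

-- single-problem summit: the doubled namespace component is forced
set_option linter.dupNamespace false

namespace Summit.ResolutionOfSingularities.ResolutionOfSingularities.Theorems.FInjectiveMacaulayfication.FedderAtRationalPoint

open MvPolynomial
open Summit.ResolutionOfSingularities.ResolutionOfSingularities.Theorems.FInjectiveMacaulayfication

/-! ## The translation automorphism `Xᵢ ↦ Xᵢ + aᵢ` -/

/-- **The translation `Xᵢ ↦ Xᵢ + aᵢ` is a `k`-algebra automorphism of `k[X₀, …, X_{n-1}]`** with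
inverse `Xᵢ ↦ Xᵢ - aᵢ` (`AlgEquiv.ofAlgHom` on the two substitutions, checked on variables).
[folklore] -/
theorem exists_translate_algEquiv (k : Type) [CommRing k] (n : ℕ) (a : Fin n → k) :
    ∃ τ : MvPolynomial (Fin n) k ≃ₐ[k] MvPolynomial (Fin n) k,
      (∀ q, τ q = aeval (fun i : Fin n => X i + C (a i)) q) ∧
      (∀ q, τ.symm q = aeval (fun i : Fin n => X i - C (a i)) q) := by
  refine ⟨AlgEquiv.ofAlgHom (aeval fun i : Fin n => X i + C (a i)) (aeval fun i : Fin n => X i - C (a i))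
    ?_ ?_, fun q => rfl, fun q => rfl⟩
  · refine algHom_ext fun i => ?_
    simp only [AlgHom.comp_apply, aeval_X, map_sub, aeval_C, AlgHom.id_apply]
    rw [MvPolynomial.algebraMap_eq]
    ring
  · refine algHom_ext fun i => ?_
    simp only [AlgHom.comp_apply, aeval_X, map_add, aeval_C, AlgHom.id_apply]
    rw [MvPolynomial.algebraMap_eq]
    ring

/-- **`eval 0 ∘ τ = eval a`**: the constant coefficient of the translate `g(X + a)` is the value
`g(a)` (two ring maps out of a polynomial ring agreeing on constants and variables). [folklore] -/
theorem constantCoeff_aeval_translate {k : Type} [CommRing k] {n : ℕ} (a : Fin n → k)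
    (g : MvPolynomial (Fin n) k) :
    constantCoeff (aeval (fun i : Fin n => X i + C (a i)) g) = eval a g := by
  have h : (constantCoeff : MvPolynomial (Fin n) k →+* k).comp
      (aeval fun i : Fin n => X i + C (a i) : MvPolynomial (Fin n) k →ₐ[k] MvPolynomial (Fin n) k) =
      eval a := by
    refine ringHom_ext (fun c => ?_) (fun i => ?_)
    · simp
    · simp
  exact RingHom.congr_fun h g

/-! ## Registered form -/

/-- **FEDDER'S TEST AT A RATIONAL POINT** (stub `stub_fedderAtRationalPoint` of line `Sketch`; general
`n`, `p`): for a field `k` of characteristic `p`, `g ∈ k[X₀, …, X_{n-1}]` non-zero and a maximal ideal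
`Q` of `k[X]/(g)` lying over the `k`-point `a` (`Q ∩ k[X] = ker (eval a)`), if the translate `g(X + a)`
passes Fedder's test at the origin — `g(X + a)^(p-1) ∉ (X₀^p, …, X_{n-1}^p)` — then the local ring
`(k[X]/(g))_Q` satisfies the per-stalk clause of `FrobeniusLadder.FInjectiveMacaulayfication`: every
system of parameters is weakly regular and generates a Frobenius closed ideal. (Translation
automorphism `Xᵢ ↦ Xᵢ + aᵢ` + `Fedder.fedder_criterion_origin` + `QuotLocalizationIso` +
`DegreeZeroDescent.inlineClause_of_ringEquiv`.) [cite: Fedder1983, Prop. 1.7 and Thm. 1.12] -/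
theorem stub_fedderAtRationalPoint : ∀ (p : ℕ) [Fact p.Prime] (k : Type) [Field k] [CharP k p] (n : ℕ) (a : Fin n → k)
    (g : MvPolynomial (Fin n) k) (Q : Ideal (MvPolynomial (Fin n) k ⧸ Ideal.span {g})) [Q.IsMaximal],
    Q.comap (Ideal.Quotient.mk (Ideal.span {g})) = RingHom.ker (MvPolynomial.eval a) → g ≠ 0 →
    (MvPolynomial.aeval (fun i : Fin n => MvPolynomial.X i + MvPolynomial.C (a i)) g) ^ (p - 1) ∉
      Ideal.span (Set.range fun i : Fin n => (MvPolynomial.X i : MvPolynomial (Fin n) k) ^ p) →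
    ∀ d : ℕ, ringKrullDim (Localization.AtPrime Q) = d → ∀ s : Fin d → Localization.AtPrime Q,
      (Ideal.span (Set.range s)).radical.IsMaximal →
        RingTheory.Sequence.IsWeaklyRegular (Localization.AtPrime Q) (List.ofFn s) ∧
        ∀ y : Localization.AtPrime Q, (∃ e : ℕ, y ^ p ^ e ∈ Ideal.span
          ((fun z : Localization.AtPrime Q => z ^ p ^ e) ''
            (Ideal.span (Set.range s) : Set (Localization.AtPrime Q)))) → y ∈ Ideal.span (Set.range s) := by
  intro p _ k _ _ n a g Q _ hQ hg0 hfed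
  obtain ⟨τ, hτ, hτs⟩ := exists_translate_algEquiv k n a
  haveI hPmax := Fedder.isMaximal_span_range_X k n
  -- `g(a) = 0`: `g ∈ Q ∩ S = ker (eval a)`
  have hga : eval a g = 0 := by
    have h : g ∈ Q.comap (Ideal.Quotient.mk (Ideal.span {g})) := by
      rw [Ideal.mem_comap, Ideal.Quotient.eq_zero_iff_mem.mpr (Ideal.mem_span_singleton_self g)]
      exact Q.zero_mem
    rwa [hQ, RingHom.mem_ker] at h
  -- the translate `g' = g(X + a) = τ g` is a non-zero element of `(X₀, …, X_{n-1})`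
  generalize hg' :
    MvPolynomial.aeval (fun i : Fin n => MvPolynomial.X i + MvPolynomial.C (a i)) g = g' at hfed
  have hτg : τ g = g' := by rw [hτ, hg']
  have hg'P : g' ∈ Ideal.span (Set.range (X : Fin n → MvPolynomial (Fin n) k)) := by
    rw [← hg', Fedder.span_range_X_eq_ker, RingHom.mem_ker, constantCoeff_aeval_translate, hga]
  have hg'0 : g' ≠ 0 := by
    intro h
    rw [← hτg] at h
    exact hg0 (τ.injective (by rw [h, map_zero]))
  -- `S/(g) ≅ S/(g')` along `τ`
  have hIJ : Ideal.span {g'} =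
      (Ideal.span {g}).map (τ.toRingEquiv : MvPolynomial (Fin n) k →+* MvPolynomial (Fin n) k) := by
    rw [Ideal.map_span, Set.image_singleton]
    exact congrArg (fun x : MvPolynomial (Fin n) k => Ideal.span {x}) hτg.symm
  obtain ⟨ε, hεs⟩ : ∃ ε : (MvPolynomial (Fin n) k ⧸ Ideal.span {g}) ≃+*
      (MvPolynomial (Fin n) k ⧸ Ideal.span {g'}),
      ∀ x : MvPolynomial (Fin n) k, ε.symm (Ideal.Quotient.mk (Ideal.span {g'}) x) =
        Ideal.Quotient.mk (Ideal.span {g}) (τ.symm x) :=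
    ⟨Ideal.quotientEquiv _ _ τ.toRingEquiv hIJ, fun x => rfl⟩
  -- the maximal ideal `Q' = ε Q` of `S/(g')` lies over the origin
  have hQ' : (Q.comap ε.symm.toRingHom).comap (Ideal.Quotient.mk (Ideal.span {g'})) =
      Ideal.span (Set.range (X : Fin n → MvPolynomial (Fin n) k)) := by
    symm
    refine hPmax.eq_of_le (Ideal.IsPrime.ne_top inferInstance) ?_
    rw [Ideal.span_le]
    rintro _ ⟨i, rfl⟩
    rw [SetLike.mem_coe, Ideal.mem_comap, Ideal.mem_comap, RingEquiv.toRingHom_eq_coe,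
      RingEquiv.coe_toRingHom, hεs]
    have h : τ.symm (X i) ∈ Q.comap (Ideal.Quotient.mk (Ideal.span {g})) := by
      rw [hQ, RingHom.mem_ker, hτs, aeval_X, map_sub, eval_X, eval_C, sub_self]
    exact Ideal.mem_comap.mp h
  -- Fedder at the origin for `g'`, then two transports
  have hL :=
    (Fedder.fedder_criterion_origin p k n (Ideal.span (Set.range X)) rfl g' hg'P hg'0).mpr hfed
  obtain ⟨e₁⟩ := QuotLocalizationIso.stub_quotLocalizationIso (MvPolynomial (Fin n) k) g'
    (Ideal.span (Set.range X)) (Q.comap ε.symm.toRingHom) hQ'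
  have hL' := DegreeZeroDescent.inlineClause_of_ringEquiv p e₁ hL
  obtain ⟨e₂⟩ := E8Char5FiModel.nonempty_ringEquiv_localization_comap ε.symm Q
  have key := DegreeZeroDescent.inlineClause_of_ringEquiv p e₂ hL'
  exact key

end Summit.ResolutionOfSingularities.ResolutionOfSingularities.Theorems.FInjectiveMacaulayfication.FedderAtRationalPoint
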